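import Summits.QuantumAdvantage.QuantumAdvantage.Theorems.OddPrimeWalkTypeDialA1
import HarnessLib

/-!
# The CROSS-SKETCH LAW of the odd-prime u-walk game (TypeDial, part A: the law and the signature corollary; dial/bookkeeping in part A1)

decomp-qadv lens-1 g19 (node HOME/decomp-qadv-lens-1/g19/TypeDial.lean, NODE-g19.md).  At a separator `m`, a strategy is
NARROW of width `k` and degree `D` (`NarrowAt`) when the cuts `g ≤ m` see the bits `≥ m` only through `k` Boolean sketch
functions of `𝔽_p`-degree `≤ D` and the cuts `g > m` see the bits `< m` only through `k` such functions (own side arbitrary).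
`crossSketchLaw` (every prime `p ≠ 3`): `k·D ≤ c₀·√(min side)` ⇒ `#LOSE ≥ η·2ⁿ` at every charge.  PROOF = the class-blind
pair law `OddConfig.classBlind_mul_le_card_lose` + Smolensky level-set elimination `elimLevelSqrtF` applied to the avoidance
function of the sketch partition (`balance_core`).  COROLLARY `fewSignaturesSqrtLaw`: the `√n`-regime of the signature law
(item 24167's hypotheses with `ZMod 5 ↦ ZMod p`).  Support toward item 23109 `ManyReadersSqrtOdd` (part B proves its NARROW piece).
-/

set_option linter.unusedVariables false
set_option linter.unusedSectionVars false
set_option linter.dupNamespace false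

noncomputable section

namespace Summit.QuantumAdvantage.QuantumAdvantage.Theorems.TypeDial

open Finset Classical
open Summit.QuantumAdvantage.AdviceFreeQNC0
open Summit.QuantumAdvantage.AdviceFreeQNC0.OddConfig
open Literature.Computability.MetaComplexity


/-! ## §5 THE LAW -/

/-- **`crossSketchLaw` (NEW RUNG LAW, every prime `p ≠ 3`).**  There are `η, c₀ > 0` and `m₀` such that: at a separator
`m` with both sides `≥ m₀`, if the strategy's cross-talk passes in BOTH directions through `k` Boolean sketch functions of
`𝔽_p`-degree `≤ D` with `k·D ≤ c₀·√m` and `k·D ≤ c₀·√(n−m)` (`NarrowAt`), then `#LOSE ≥ η·2ⁿ` at every charge. -/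
theorem crossSketchLaw (p : ℕ) [Fact p.Prime] (hp3 : p ≠ 3) :
    ∃ η : ℝ, 0 < η ∧ ∃ c₀ : ℝ, 0 < c₀ ∧ ∃ m₀ : ℕ, ∀ n m c k D : ℕ, ∀ y : Fin (n + 1) → (Fin n → Bool) → Bool,
      m₀ ≤ m → m₀ ≤ n - m → m ≤ n → ((k * D : ℕ) : ℝ) ≤ c₀ * Real.sqrt m →
      ((k * D : ℕ) : ℝ) ≤ c₀ * Real.sqrt (n - m : ℕ) → NarrowAt p n m k D y →
      η * (2 : ℝ) ^ n ≤ ((Finset.univ.filter fun u : Fin n → Bool => ¬ ringWinU c y u = true).card : ℝ) := by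
  obtain ⟨η₀, hη₀, c₀, hc₀, m₀, H⟩ := balance_core p hp3
  refine ⟨η₀ ^ 2 / 9, by positivity, c₀, hc₀, m₀, fun n m c k D y hm hnm hmn hkA hkB hN => ?_⟩
  obtain ⟨bA, bB, hdA, hdB, hA, hB⟩ := hN
  -- the class-blind pair law with the sketch labellings
  have hCB := classBlind_mul_le_card_lose m c y (fun s : Fin n → Bool => fun i => bA i s)
    (fun t : Fin n → Bool => fun i => bB i t)
    (fun g hg s t t' h => hA g hg s t t' (fun i => congrFun h i))
    (fun g hg s s' t h => hB g hg s s' t (fun i => congrFun h i))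
  -- balance of the two sketch partitions
  have hSA : η₀ * (2 : ℝ) ^ m ≤ ((∑ l : Fin k → Bool, minCellA m (fun s : Fin n → Bool => fun i => bA i s) l : ℕ) : ℝ) := by
    have h := H m hm k D hkA (fun i (v : Fin m → Bool) => bA i (extA m v)) (fun i => hasDeg_extA (hdA i) m)
    have e : (∑ l : Fin k → Bool, minCellA m (fun s : Fin n → Bool => fun i => bA i s) l) =
        ∑ l : Fin k → Bool, min3 (cubeCell (fun i (v : Fin m → Bool) => bA i (extA m v)) l) := by
      refine Finset.sum_congr rfl fun l _ => ?_
      unfold minCellA min3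
      rw [card_cellA_eq hmn, card_cellA_eq hmn, card_cellA_eq hmn]
    rw [e]; exact h
  have hSB : η₀ * (2 : ℝ) ^ (n - m) ≤
      ((∑ l : Fin k → Bool, minCellB m (fun t : Fin n → Bool => fun i => bB i t) l : ℕ) : ℝ) := by
    have h := H (n - m) hnm k D hkB (fun i (v : Fin (n - m) → Bool) => bB i (extB m v)) (fun i => hasDeg_extB (hdB i) m)
    have e : (∑ l : Fin k → Bool, minCellB m (fun t : Fin n → Bool => fun i => bB i t) l) =
        ∑ l : Fin k → Bool, min3 (cubeCell (fun i (v : Fin (n - m) → Bool) => bB i (extB m v)) l) := by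
      refine Finset.sum_congr rfl fun l _ => ?_
      unfold minCellB min3
      rw [card_cellB_eq hmn, card_cellB_eq hmn, card_cellB_eq hmn]
    rw [e]; exact h
  have hCB' : ((∑ l : Fin k → Bool, minCellA m (fun s : Fin n → Bool => fun i => bA i s) l : ℕ) : ℝ) *
      ((∑ l : Fin k → Bool, minCellB m (fun t : Fin n → Bool => fun i => bB i t) l : ℕ) : ℝ) ≤
      9 * ((Finset.univ.filter fun u : Fin n → Bool => ¬ ringWinU c y u = true).card : ℝ) := by
    exact_mod_cast hCB
  have h2 : (2 : ℝ) ^ n = (2 : ℝ) ^ m * (2 : ℝ) ^ (n - m) := by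
    rw [← pow_add, Nat.add_sub_cancel' hmn]
  have hA0 : (0 : ℝ) ≤ η₀ * (2 : ℝ) ^ m := by positivity
  have hB0 : (0 : ℝ) ≤ η₀ * (2 : ℝ) ^ (n - m) := by positivity
  have hprod := mul_le_mul hSA hSB hB0 (le_trans hA0 hSA)
  have h3 : η₀ ^ 2 * (2 : ℝ) ^ n ≤ 9 * ((Finset.univ.filter fun u : Fin n → Bool => ¬ ringWinU c y u = true).card : ℝ) :=
    calc η₀ ^ 2 * (2 : ℝ) ^ n = η₀ * (2 : ℝ) ^ m * (η₀ * (2 : ℝ) ^ (n - m)) := by rw [h2]; ring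
      _ ≤ _ := le_trans hprod hCB'
  linarith

/-- total count: wins + losses = `2ⁿ`. -/
theorem card_win_add_card_lose {n : ℕ} (c : ℕ) (y : Fin (n + 1) → (Fin n → Bool) → Bool) :
    ((Finset.univ.filter fun u : Fin n → Bool => ringWinU c y u = true).card : ℝ) +
      ((Finset.univ.filter fun u : Fin n → Bool => ¬ ringWinU c y u = true).card : ℝ) = (2 : ℝ) ^ n := by
  have h := Finset.card_filter_add_card_filter_not (s := (Finset.univ : Finset (Fin n → Bool)))
    (fun u : Fin n → Bool => ringWinU c y u = true)
  rw [Finset.card_univ, Fintype.card_fun, Fintype.card_bool, Fintype.card_fin] at h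
  exact_mod_cast h

/-- **The law in WIN form**: `#WIN ≤ (1 − η)·2ⁿ`. -/
theorem crossSketchLaw_win (p : ℕ) [Fact p.Prime] (hp3 : p ≠ 3) :
    ∃ θ : ℝ, θ < 1 ∧ ∃ c₀ : ℝ, 0 < c₀ ∧ ∃ m₀ : ℕ, ∀ n m c k D : ℕ, ∀ y : Fin (n + 1) → (Fin n → Bool) → Bool,
      m₀ ≤ m → m₀ ≤ n - m → m ≤ n → ((k * D : ℕ) : ℝ) ≤ c₀ * Real.sqrt m →
      ((k * D : ℕ) : ℝ) ≤ c₀ * Real.sqrt (n - m : ℕ) → NarrowAt p n m k D y →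
      ((Finset.univ.filter fun u : Fin n → Bool => ringWinU c y u = true).card : ℝ) ≤ θ * (2 : ℝ) ^ n := by
  obtain ⟨η, hη, c₀, hc₀, m₀, H⟩ := crossSketchLaw p hp3
  refine ⟨1 - η, by linarith, c₀, hc₀, m₀, fun n m c k D y hm hnm hmn hkA hkB hN => ?_⟩
  have h := H n m c k D y hm hnm hmn hkA hkB hN
  have htot := card_win_add_card_lose c y
  linarith

/-! ## §7 Corollary: LINEAR SIGNATURES — the `√n`-regime of item 24167 `FewSignaturesPairLaw`, for EVERY prime `p ≠ 3`

A cut that is an arbitrary function of (own bits, the values of `s` linear forms mod `p` on the far bits) is narrow with the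
`s·p` Boolean sketches `[σ_k = r]` (`𝔽_p`-degree `p − 1`, Fermat; tree `hasDegF_linTest`).  Hence `crossSketchLaw` gives the
signature law of item 24167 (there: `p = 5`, budget `s·K ≤ m` LINEAR, OPEN) in the budget `s·p² ≤ c₀·√(min side)`, all `p ≠ 3`. -/

section Signatures

variable {p : ℕ} [Fact p.Prime] {n : ℕ}

/-- Bob-side masked linear signature `Σ_{i ≥ m} β_i u_i` (scalar, `ZMod p`; not the vector-valued `ZMod 5` signature
`sigB` of `Theorems/OddPrimeWalkSignatureBalance`). -/
def sigB (m : ℕ) (β : Fin n → ZMod p) (u : Fin n → Bool) : ZMod p :=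
  ∑ i : Fin n, if m ≤ i.val ∧ u i = true then β i else 0

/-- Alice-side masked linear signature `Σ_{i < m} α_i u_i` (scalar; cf. the vector-valued `sigA` of
`Theorems/OddPrimeWalkSignatureBalance`). -/
def sigA (m : ℕ) (α : Fin n → ZMod p) (u : Fin n → Bool) : ZMod p :=
  ∑ i : Fin n, if i.val < m ∧ u i = true then α i else 0

/-- `sigB` as a masked linear form. -/
theorem sigB_eq_linForm (m : ℕ) (β : Fin n → ZMod p) (u : Fin n → Bool) :
    sigB m β u = ∑ i : Fin n, (if u i then (if m ≤ i.val then β i else 0) else 0) := by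
  unfold sigB
  refine Finset.sum_congr rfl fun i _ => ?_
  by_cases h1 : m ≤ i.val <;> by_cases h2 : u i = true <;> simp [h1, h2]

/-- `sigA` as a masked linear form. -/
theorem sigA_eq_linForm (m : ℕ) (α : Fin n → ZMod p) (u : Fin n → Bool) :
    sigA m α u = ∑ i : Fin n, (if u i then (if i.val < m then α i else 0) else 0) := by
  unfold sigA
  refine Finset.sum_congr rfl fun i _ => ?_
  by_cases h1 : i.val < m <;> by_cases h2 : u i = true <;> simp [h1, h2]

/-- a residue test of a masked signature has `𝔽_p`-degree `p − 1`. -/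
theorem hasDegF_sigB_test (m : ℕ) (β : Fin n → ZMod p) (r : ZMod p) :
    HasDegF p (fun u => decide (sigB m β u = r)) (p - 1) := by
  have e : (fun u => decide (sigB m β u = r)) =
      fun u : Fin n → Bool => decide ((∑ i, (if u i then (if m ≤ i.val then β i else 0) else 0)) = r) := by
    funext u; rw [sigB_eq_linForm]
  rw [e]; exact hasDegF_linTest _ r

/-- the level-set test `[sigA = r]` has `𝔽_p`-degree `≤ p - 1`. -/
theorem hasDegF_sigA_test (m : ℕ) (α : Fin n → ZMod p) (r : ZMod p) :
    HasDegF p (fun u => decide (sigA m α u = r)) (p - 1) := by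
  have e : (fun u => decide (sigA m α u = r)) =
      fun u : Fin n → Bool => decide ((∑ i, (if u i then (if i.val < m then α i else 0) else 0)) = r) := by
    funext u; rw [sigA_eq_linForm]
  rw [e]; exact hasDegF_linTest _ r

/-- `sigB` of a glued input depends only on the Bob half. -/
theorem sigB_glue (m : ℕ) (β : Fin n → ZMod p) (s t : Fin n → Bool) :
    sigB m β (fun i => if i.val < m then s i else t i) = sigB m β t := by
  unfold sigB
  refine Finset.sum_congr rfl fun i _ => ?_
  by_cases h1 : m ≤ i.val
  · have h2 : ¬ i.val < m := by omega
    simp [h1, h2]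
  · simp [h1]

/-- `sigA` of a glued input depends only on the Alice half. -/
theorem sigA_glue (m : ℕ) (α : Fin n → ZMod p) (s t : Fin n → Bool) :
    sigA m α (fun i => if i.val < m then s i else t i) = sigA m α s := by
  unfold sigA
  refine Finset.sum_congr rfl fun i _ => ?_
  by_cases h1 : i.val < m
  · simp [h1]
  · simp [h1]

/-- the `s·p` Boolean sketches of Bob's half: `[σ_k(u) = r]`, `(k, r) ∈ Fin s × Fin p`. -/
def sketchB (m s : ℕ) (β : Fin s → Fin n → ZMod p) (i : Fin (s * p)) : (Fin n → Bool) → Bool :=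
  fun u => decide (sigB m (β (finProdFinEquiv.symm i).1) u = (((finProdFinEquiv.symm i).2).val : ZMod p))

/-- the `s·p` Boolean sketches of Alice's half. -/
def sketchA (m s : ℕ) (α : Fin s → Fin n → ZMod p) (i : Fin (s * p)) : (Fin n → Bool) → Bool :=
  fun u => decide (sigA m (α (finProdFinEquiv.symm i).1) u = (((finProdFinEquiv.symm i).2).val : ZMod p))

/-- equal Bob-side signatures give equal `sigB` values. -/
theorem sigB_eq_of_sketch {m s : ℕ} {β : Fin s → Fin n → ZMod p} {t t' : Fin n → Bool}
    (h : ∀ i, sketchB m s β i t = sketchB m s β i t') (k : Fin s) : sigB m (β k) t = sigB m (β k) t' := by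
  haveI : NeZero p := ⟨(Fact.out : p.Prime).ne_zero⟩
  have hi := h (finProdFinEquiv (k, ⟨(sigB m (β k) t).val, ZMod.val_lt _⟩))
  simp only [sketchB, Equiv.symm_apply_apply, ZMod.natCast_zmod_val, decide_true] at hi
  exact (of_decide_eq_true hi.symm).symm

/-- equal Alice-side signatures give equal `sigA` values. -/
theorem sigA_eq_of_sketch {m s : ℕ} {α : Fin s → Fin n → ZMod p} {u u' : Fin n → Bool}
    (h : ∀ i, sketchA m s α i u = sketchA m s α i u') (k : Fin s) : sigA m (α k) u = sigA m (α k) u' := by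
  haveI : NeZero p := ⟨(Fact.out : p.Prime).ne_zero⟩
  have hi := h (finProdFinEquiv (k, ⟨(sigA m (α k) u).val, ZMod.val_lt _⟩))
  simp only [sketchA, Equiv.symm_apply_apply, ZMod.natCast_zmod_val, decide_true] at hi
  exact (of_decide_eq_true hi.symm).symm

/-- signature strategies are NARROW: width `s·p`, degree `p − 1`. -/
theorem narrowAt_of_signatures (m s : ℕ) (y : Fin (n + 1) → (Fin n → Bool) → Bool) (α β : Fin s → Fin n → ZMod p)
    (hA : ∀ g : Fin (n + 1), g.val ≤ m → ∃ F : (Fin n → Bool) → (Fin s → ZMod p) → Bool, ∀ u : Fin n → Bool,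
      y g u = F (fun i => decide (i.val < m) && u i) (fun k => ∑ i : Fin n, if m ≤ i.val ∧ u i = true then β k i else 0))
    (hB : ∀ g : Fin (n + 1), m < g.val → ∃ F : (Fin n → Bool) → (Fin s → ZMod p) → Bool, ∀ u : Fin n → Bool,
      y g u = F (fun i => decide (m ≤ i.val) && u i) (fun k => ∑ i : Fin n, if i.val < m ∧ u i = true then α k i else 0)) :
    NarrowAt p n m (s * p) (p - 1) y := by
  refine ⟨sketchA m s α, sketchB m s β, fun i => hasDegF_sigA_test _ _ _, fun i => hasDegF_sigB_test _ _ _, ?_, ?_⟩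
  · intro g hg u t t' hbb
    obtain ⟨F, hF⟩ := hA g hg
    rw [hF, hF]
    congr 1
    · funext i
      by_cases hi : i.val < m <;> simp [hi]
    · funext k
      show sigB m (β k) _ = sigB m (β k) _
      rw [sigB_glue, sigB_glue]
      exact sigB_eq_of_sketch hbb k
  · intro g hg u u' t haa
    obtain ⟨F, hF⟩ := hB g hg
    rw [hF, hF]
    congr 1
    · funext i
      by_cases hi : i.val < m
      · have h2 : ¬ m ≤ i.val := by omega
        simp [hi, h2]
      · have h2 : m ≤ i.val := by omega
        simp [hi, h2]
    · funext k
      show sigA m (α k) _ = sigA m (α k) _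
      rw [sigA_glue, sigA_glue]
      exact sigA_eq_of_sketch haa k

end Signatures

/-- **`fewSignaturesSqrtLaw`** (COROLLARY of `crossSketchLaw`; every prime `p ≠ 3`): the signature pair law of item 24167
`FewSignaturesPairLaw` (ARBITRARY functions of (own bits, `s` linear signatures mod `p` of the far bits) on each side of a
separator) in the budget `s·p² ≤ c₀·√(min side)` — hypotheses of 24167 verbatim with `ZMod 5 ↦ ZMod p`. -/
theorem fewSignaturesSqrtLaw (p : ℕ) [Fact p.Prime] (hp3 : p ≠ 3) :
    ∃ θ : ℝ, θ < 1 ∧ ∃ c₀ : ℝ, 0 < c₀ ∧ ∃ m₀ : ℕ, ∀ n m c s : ℕ, ∀ y : Fin (n + 1) → (Fin n → Bool) → Bool,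
      m₀ ≤ m → m₀ ≤ n - m → m ≤ n → ((s * p ^ 2 : ℕ) : ℝ) ≤ c₀ * Real.sqrt m →
      ((s * p ^ 2 : ℕ) : ℝ) ≤ c₀ * Real.sqrt (n - m : ℕ) → ∀ α β : Fin s → Fin n → ZMod p,
      (∀ g : Fin (n + 1), g.val ≤ m → ∃ F : (Fin n → Bool) → (Fin s → ZMod p) → Bool, ∀ u : Fin n → Bool,
        y g u = F (fun i => decide (i.val < m) && u i) (fun k => ∑ i : Fin n, if m ≤ i.val ∧ u i = true then β k i else 0)) →
      (∀ g : Fin (n + 1), m < g.val → ∃ F : (Fin n → Bool) → (Fin s → ZMod p) → Bool, ∀ u : Fin n → Bool,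
        y g u = F (fun i => decide (m ≤ i.val) && u i) (fun k => ∑ i : Fin n, if i.val < m ∧ u i = true then α k i else 0)) →
      ((Finset.univ.filter fun u : Fin n → Bool => ringWinU c y u = true).card : ℝ) ≤ θ * (2 : ℝ) ^ n := by
  obtain ⟨θ, hθ, c₀, hc₀, m₀, H⟩ := crossSketchLaw_win p hp3
  refine ⟨θ, hθ, c₀, hc₀, m₀, fun n m c s y hm hnm hmn hsA hsB α β hA hB => ?_⟩
  have hkD : s * p * (p - 1) ≤ s * p ^ 2 := by
    have h1 : p - 1 ≤ p := Nat.sub_le p 1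
    calc s * p * (p - 1) ≤ s * p * p := Nat.mul_le_mul_left _ h1
      _ = s * p ^ 2 := by ring
  have hkD' : ((s * p * (p - 1) : ℕ) : ℝ) ≤ ((s * p ^ 2 : ℕ) : ℝ) := by exact_mod_cast hkD
  exact H n m c (s * p) (p - 1) y hm hnm hmn (le_trans hkD' hsA) (le_trans hkD' hsB)
    (narrowAt_of_signatures m s y α β hA hB)

end Summit.QuantumAdvantage.QuantumAdvantage.Theorems.TypeDial
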